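import Summits.BirchSwinnertonDyer.BirchSwinnertonDyer.Theorems.PrintX6BSTWByName
import Summits.BirchSwinnertonDyer.Rank1Residual.Supersingular.X6RankZeroErratumDefs
import Summits.BirchSwinnertonDyer.Rank1Residual.Supersingular.X6RankZeroInertPairDefs
import Summits.BirchSwinnertonDyer.Rank1Residual.Supersingular.X6RankZeroInertPairGuardDefs
import HarnessLib

/-!
# Route `PrintX6` — the THIN residual («RestThin») of the crux `EisensteinHalfFiveLe` BY NAME from
# Burungale–Skinner–Tian–Wan 2024 (cell `bsd-print-x6`, seat p1; lane «BSTW Thm 1.3/1.5 BY NAME»)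

STATE (2026-08-27T22:0xZ). The residual child `EisensteinHalfFiveLeRest` (stmt-BirchSwinnertonDyer-21116: E₅ at `p ≥ 5`
off the erratum sub-locus) is cut down in the kernel by road (I)/(R2) of seat p3: on the INERT-PAIR sub-class
(`Supersingular.HasInertPair W p`, ty2 p561619: two multiplicative primes `ℓ₁ ≠ ℓ₂` with `p ∤ ord_{ℓ_i}(Δ_min)`) it holds
BY NAME from published facts (`AnticyclotomicRankZero.eisensteinHalfFiveLeRestPair_of_facts`, p566173), and
Rest ⟸ pack ∧ THIN by `Classical.em` (same file). What is LEFT at `p ≥ 5` is the THIN part — E₅ at leaf pairs with no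
erratum prime AND no inert pair (0 of the 113 non-unit census cells, ty3 p561444) — spelled INLINE below exactly as the
planner's staged resplit child `EisensteinHalfFiveLeRestThin` (HOME/plan/children5.json; the `--resplit` itself awaits
the tenure planner / operator, plan INBOX 2026-08-27T21:57:05Z, so no route decl of that name exists yet).

WHAT THIS FILE DOES. The THIN statement is a WEAKENING of the parent crux `EisensteinHalfFiveLe` and of the residual
child `EisensteinHalfFiveLeRest` (§0, pure logic: idle hypotheses), hence inherits every by-name road of
`PrintX6BSTWByName.lean` (p541401): S (`p ≥ 5` S-scoped preprint tier + published inputs + Diamond 1995 / Ribet 1990),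
P (Thm. 1.3 as printed + inputs), V (Thm. 1.5 + GZK), K (the sister route's crux `KobayashiLowerHalfSemistable`,
stmt-BirchSwinnertonDyer-19000, + inputs) — §1–§4, each ONE composition. These are the THIN residual's ONLY class-level
roads; all CONDITIONAL on a PREPRINT binder (arXiv:2409.01350, `[claim: …, status: under-review]`) or an OPEN item.
When the resplit lands, each theorem here is definitionally a term of the child `EisensteinHalfFiveLeRestThin`
(by-name twins then follow append-only). Nothing is discharged; no `def`, no named fact, no restatement of an item.
PARTITION: 0 cells; BEYOND-PRINT THEOREM: NO.
-/

set_option autoImplicit false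
-- the landed namespace `Summit.BirchSwinnertonDyer.BirchSwinnertonDyer.Theorems.PrintX6` (summit = problem) trips the linter
set_option linter.dupNamespace false

noncomputable section

open scoped Classical

open WeierstrassCurve Literature.NumberTheory.EllipticCurves
  Literature.NumberTheory.EllipticCurves.Rank1Residual
  Literature.NumberTheory.EllipticCurves.BurungaleSkinnerTianWan2024
  Summit.BirchSwinnertonDyer.BirchSwinnertonDyer.Theses.PrintX6
-- only these names from ty2's namespace (its packs would otherwise clash with the route's decls of the same name)
open Summit.BirchSwinnertonDyer.Rank1Residual.Supersingular (HasErratumPrime HasInertPair HasInertPairPrimeToUnits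
  BurungaleSkinnerTianWan2024_thm13_scopedS_OPEN BurungaleSkinnerTianWan2024_thm13_OPEN)

namespace Summit.BirchSwinnertonDyer.BirchSwinnertonDyer.Theorems.PrintX6

/-! ### §0 The THIN statement is a weakening of the parent crux and of the residual child (pure logic) -/

/-- **THIN ⟸ parent.** The thin residual (E₅ at `p ≥ 5`, no erratum prime, no inert pair; the staged resplit child
`EisensteinHalfFiveLeRestThin` spelled inline) is the parent crux `EisensteinHalfFiveLe` (stmt-BirchSwinnertonDyer-20276)
with two extra, unused hypotheses. Pure logic; unconditional. -/
theorem eisensteinHalfFiveLeRestThin_of_eisensteinHalfFiveLe (h : EisensteinHalfFiveLe) :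
    ∀ (W : WeierstrassCurve ℚ) [W.IsElliptic] [W.IsGloballyMinimal] (p : ℕ) [Fact p.Prime],
      ¬ W.HasCM → 5 ≤ p → ClassX6 W p → W.analyticRank = 0 → ¬ HasErratumPrime W p → ¬ HasInertPair W p →
      ∀ q : ℚ, shaAn W = (q : ℂ) → padicValRat p q ≠ 0 → padicValRat p q ≤ (padicValNat p W.shaOrder : ℤ) :=
  fun W _ _ p _ hCM h5 hX h0 _ _ q hq hv ↦ h W p hCM h5 hX h0 q hq hv

/-- **THIN ⟸ Rest.** The thin residual is the residual child `EisensteinHalfFiveLeRest` (stmt-BirchSwinnertonDyer-21116)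
with one extra, unused hypothesis (`¬ HasInertPair W p`); with p3's `eisensteinHalfFiveLeRestPair_of_facts` + em-glue
(p566173) the converse holds under the road-(R2) pack, so THIN is exactly what is left of 21116. Pure logic. -/
theorem eisensteinHalfFiveLeRestThin_of_eisensteinHalfFiveLeRest (h : EisensteinHalfFiveLeRest) :
    ∀ (W : WeierstrassCurve ℚ) [W.IsElliptic] [W.IsGloballyMinimal] (p : ℕ) [Fact p.Prime],
      ¬ W.HasCM → 5 ≤ p → ClassX6 W p → W.analyticRank = 0 → ¬ HasErratumPrime W p → ¬ HasInertPair W p →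
      ∀ q : ℚ, shaAn W = (q : ℂ) → padicValRat p q ≠ 0 → padicValRat p q ≤ (padicValNat p W.shaOrder : ℤ) :=
  fun W _ _ p _ hCM h5 hX h0 hnE _ q hq hv ↦ h W p hCM h5 hX h0 hnE q hq hv

/-! ### §1 Road S — the `p ≥ 5` S-scoped tier -/

/-- **THIN BY NAME on road S**: `PublishedInputsX6 → diamond1995_refinedSerre → thm13_scopedS_OPEN → THIN`, one
composition with `eisensteinHalfFiveLe_of_thm13_scopedS_OPEN` (p541401: the tier applied at the leaf — semistable,
good supersingular, `a_p`-datum `h4_of_classX6`, scope witness `hasAuxWitness_of_leaf` from modularity + Diamond/Ribet —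
then ty2's descent adapter over Kobayashi Thm. 1.2, Kim Cor. 3.15, GZK). CONDITIONAL on the PRE tier; credits nothing.
[claim: BurungaleSkinnerTianWan2024, status: under-review] [cite: Kobayashi2003, Thm. 1.2 and Conjecture (p. 2)]
[cite: BDKim2013, Cor. 3.15 (p. 199)] [cite: Ribet1990, Thm. 1.1] [cite: Miller2011LMS, Def. 1.1] -/
theorem eisensteinHalfFiveLeRestThin_of_thm13_scopedS_OPEN (hPub : PublishedInputsX6)
    (hLL : Literature.NumberTheory.Automorphic.diamond1995_refinedSerre)
    (h5t : BurungaleSkinnerTianWan2024_thm13_scopedS_OPEN) :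
    ∀ (W : WeierstrassCurve ℚ) [W.IsElliptic] [W.IsGloballyMinimal] (p : ℕ) [Fact p.Prime],
      ¬ W.HasCM → 5 ≤ p → ClassX6 W p → W.analyticRank = 0 → ¬ HasErratumPrime W p → ¬ HasInertPair W p →
      ∀ q : ℚ, shaAn W = (q : ℂ) → padicValRat p q ≠ 0 → padicValRat p q ≤ (padicValNat p W.shaOrder : ℤ) :=
  eisensteinHalfFiveLeRestThin_of_eisensteinHalfFiveLe (eisensteinHalfFiveLe_of_thm13_scopedS_OPEN hPub hLL h5t)

/-! ### §2 Road P — Thm. 1.3 as printed (no scope hypothesis, no level-lowering input) -/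

/-- **THIN BY NAME on road P**: `PublishedInputsX6 → thm13_OPEN → THIN`. CONDITIONAL; credits nothing.
[claim: BurungaleSkinnerTianWan2024, status: under-review] [cite: Kobayashi2003, Thm. 1.2 and Conjecture (p. 2)]
[cite: BDKim2013, Cor. 3.15 (p. 199)] [cite: Miller2011LMS, Def. 1.1] -/
theorem eisensteinHalfFiveLeRestThin_of_thm13_OPEN (hPub : PublishedInputsX6)
    (h13 : BurungaleSkinnerTianWan2024_thm13_OPEN) :
    ∀ (W : WeierstrassCurve ℚ) [W.IsElliptic] [W.IsGloballyMinimal] (p : ℕ) [Fact p.Prime],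
      ¬ W.HasCM → 5 ≤ p → ClassX6 W p → W.analyticRank = 0 → ¬ HasErratumPrime W p → ¬ HasInertPair W p →
      ∀ q : ℚ, shaAn W = (q : ℂ) → padicValRat p q ≠ 0 → padicValRat p q ≤ (padicValNat p W.shaOrder : ℤ) :=
  eisensteinHalfFiveLeRestThin_of_eisensteinHalfFiveLe (eisensteinHalfFiveLe_of_thm13_OPEN hPub h13)

/-! ### §3 Road V — Thm. 1.5 (the value statement) + GZK -/

/-- **THIN BY NAME on road V**: `thm15_pPart_OPEN → GZK → THIN`. CONDITIONAL; credits nothing.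
[claim: BurungaleSkinnerTianWan2024, status: under-review] [cite: Kobayashi2003, Thm. 1.2 (p. 2)]
[cite: Miller2011LMS, Def. 1.1] -/
theorem eisensteinHalfFiveLeRestThin_of_thm15_OPEN (h15 : thm15_pPart_OPEN)
    (hGZK : rank_eq_analyticRank_of_analyticRank_le_one) :
    ∀ (W : WeierstrassCurve ℚ) [W.IsElliptic] [W.IsGloballyMinimal] (p : ℕ) [Fact p.Prime],
      ¬ W.HasCM → 5 ≤ p → ClassX6 W p → W.analyticRank = 0 → ¬ HasErratumPrime W p → ¬ HasInertPair W p →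
      ∀ q : ℚ, shaAn W = (q : ℂ) → padicValRat p q ≠ 0 → padicValRat p q ≤ (padicValNat p W.shaOrder : ℤ) :=
  eisensteinHalfFiveLeRestThin_of_eisensteinHalfFiveLe (eisensteinHalfFiveLe_of_thm15_OPEN h15 hGZK)

/-! ### §4 Road K — the sister route's crux `KobayashiLowerHalfSemistable` (stmt-BirchSwinnertonDyer-19000) -/

/-- **THIN from the sister crux** (route `SignedLowerHalves`, cell bsd-ssimc; OPEN item) + the published inputs, via
`eisensteinHalves_of_kobayashiLowerHalfSemistable` (p541401). CONDITIONAL on an OPEN item; closes nothing.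
[cite: Kobayashi2003, Thm. 1.2 and Conjecture (p. 2)] [cite: BDKim2013, Cor. 3.15 (p. 199)] [cite: Miller2011LMS, Def. 1.1] -/
theorem eisensteinHalfFiveLeRestThin_of_kobayashiLowerHalfSemistable
    (h : Summit.BirchSwinnertonDyer.BirchSwinnertonDyer.Theses.SignedLowerHalves.KobayashiLowerHalfSemistable)
    (hPub : PublishedInputsX6) :
    ∀ (W : WeierstrassCurve ℚ) [W.IsElliptic] [W.IsGloballyMinimal] (p : ℕ) [Fact p.Prime],
      ¬ W.HasCM → 5 ≤ p → ClassX6 W p → W.analyticRank = 0 → ¬ HasErratumPrime W p → ¬ HasInertPair W p →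
      ∀ q : ℚ, shaAn W = (q : ℂ) → padicValRat p q ≠ 0 → padicValRat p q ≤ (padicValNat p W.shaOrder : ℤ) :=
  eisensteinHalfFiveLeRestThin_of_eisensteinHalfFiveLe (eisensteinHalves_of_kobayashiLowerHalfSemistable h hPub).1

/-! ### §5 The GUARDED thin residual («RestThinGuard», children5 v2) — appended by p1 gen 7 after β1/β2

PLAN v4.8b (R-5.3): the resplit boundary moves from `HasInertPair` to ty2's `HasInertPairPrimeToUnits` (the inert pair
with the printed pair-local unit guard `p ∤ (ℓ₁² − 1)(ℓ₂² − 1)` LAST; `X6RankZeroInertPairGuardDefs.lean`), whose Pair side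
is `AnticyclotomicRankZero.eisensteinHalfFiveLeRestPairGuard_of_facts` (p579270). The guarded THIN statement —
E₅ at `p ≥ 5`, no erratum prime, no GUARDED inert pair (census support 2 of 113: 246697a1, 321518d1 @ 5, ty3 p577965) —
is again a weakening of the parent crux, so the same four roads apply verbatim. CONDITIONAL as §1–§4. -/

/-- **THIN-GUARD ⟸ parent** (children5 v2's `EisensteinHalfFiveLeRestThinGuard` spelled inline): the parent crux with two
idle hypotheses. Pure logic; unconditional. -/
theorem eisensteinHalfFiveLeRestThinGuard_of_eisensteinHalfFiveLe (h : EisensteinHalfFiveLe) :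
    ∀ (W : WeierstrassCurve ℚ) [W.IsElliptic] [W.IsGloballyMinimal] (p : ℕ) [Fact p.Prime],
      ¬ W.HasCM → 5 ≤ p → ClassX6 W p → W.analyticRank = 0 → ¬ HasErratumPrime W p → ¬ HasInertPairPrimeToUnits W p →
      ∀ q : ℚ, shaAn W = (q : ℂ) → padicValRat p q ≠ 0 → padicValRat p q ≤ (padicValNat p W.shaOrder : ℤ) :=
  fun W _ _ p _ hCM h5 hX h0 _ _ q hq hv ↦ h W p hCM h5 hX h0 q hq hv

/-- **THIN-GUARD ⟹ THIN (v1)**: a guarded inert pair is an inert pair (`HasInertPairPrimeToUnits.toHasInertPair`), so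
`¬ HasInertPair W p → ¬ HasInertPairPrimeToUnits W p` and the guarded thin class CONTAINS §0's thin class; hence the v2
residual statement implies the v1 one. Pure logic; unconditional. -/
theorem eisensteinHalfFiveLeRestThin_of_eisensteinHalfFiveLeRestThinGuard
    (h : ∀ (W : WeierstrassCurve ℚ) [W.IsElliptic] [W.IsGloballyMinimal] (p : ℕ) [Fact p.Prime],
      ¬ W.HasCM → 5 ≤ p → ClassX6 W p → W.analyticRank = 0 → ¬ HasErratumPrime W p → ¬ HasInertPairPrimeToUnits W p →
      ∀ q : ℚ, shaAn W = (q : ℂ) → padicValRat p q ≠ 0 → padicValRat p q ≤ (padicValNat p W.shaOrder : ℤ)) :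
    ∀ (W : WeierstrassCurve ℚ) [W.IsElliptic] [W.IsGloballyMinimal] (p : ℕ) [Fact p.Prime],
      ¬ W.HasCM → 5 ≤ p → ClassX6 W p → W.analyticRank = 0 → ¬ HasErratumPrime W p → ¬ HasInertPair W p →
      ∀ q : ℚ, shaAn W = (q : ℂ) → padicValRat p q ≠ 0 → padicValRat p q ≤ (padicValNat p W.shaOrder : ℤ) :=
  fun W _ _ p _ hCM h5 hX h0 hnE hnI q hq hv ↦ h W p hCM h5 hX h0 hnE (fun hG ↦ hnI hG.toHasInertPair) q hq hv

/-- **THIN-GUARD BY NAME on road S**: `PublishedInputsX6 → diamond1995_refinedSerre → thm13_scopedS_OPEN → THIN-GUARD`.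
CONDITIONAL on the PRE tier; credits nothing. [claim: BurungaleSkinnerTianWan2024, status: under-review]
[cite: Kobayashi2003, Thm. 1.2 and Conjecture (p. 2)] [cite: BDKim2013, Cor. 3.15 (p. 199)] [cite: Ribet1990, Thm. 1.1] -/
theorem eisensteinHalfFiveLeRestThinGuard_of_thm13_scopedS_OPEN (hPub : PublishedInputsX6)
    (hLL : Literature.NumberTheory.Automorphic.diamond1995_refinedSerre)
    (h5t : BurungaleSkinnerTianWan2024_thm13_scopedS_OPEN) :
    ∀ (W : WeierstrassCurve ℚ) [W.IsElliptic] [W.IsGloballyMinimal] (p : ℕ) [Fact p.Prime],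
      ¬ W.HasCM → 5 ≤ p → ClassX6 W p → W.analyticRank = 0 → ¬ HasErratumPrime W p → ¬ HasInertPairPrimeToUnits W p →
      ∀ q : ℚ, shaAn W = (q : ℂ) → padicValRat p q ≠ 0 → padicValRat p q ≤ (padicValNat p W.shaOrder : ℤ) :=
  eisensteinHalfFiveLeRestThinGuard_of_eisensteinHalfFiveLe (eisensteinHalfFiveLe_of_thm13_scopedS_OPEN hPub hLL h5t)

/-- **THIN-GUARD BY NAME on road P**: `PublishedInputsX6 → thm13_OPEN → THIN-GUARD`. CONDITIONAL; credits nothing.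
[claim: BurungaleSkinnerTianWan2024, status: under-review] [cite: Kobayashi2003, Thm. 1.2 and Conjecture (p. 2)] -/
theorem eisensteinHalfFiveLeRestThinGuard_of_thm13_OPEN (hPub : PublishedInputsX6)
    (h13 : BurungaleSkinnerTianWan2024_thm13_OPEN) :
    ∀ (W : WeierstrassCurve ℚ) [W.IsElliptic] [W.IsGloballyMinimal] (p : ℕ) [Fact p.Prime],
      ¬ W.HasCM → 5 ≤ p → ClassX6 W p → W.analyticRank = 0 → ¬ HasErratumPrime W p → ¬ HasInertPairPrimeToUnits W p →
      ∀ q : ℚ, shaAn W = (q : ℂ) → padicValRat p q ≠ 0 → padicValRat p q ≤ (padicValNat p W.shaOrder : ℤ) :=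
  eisensteinHalfFiveLeRestThinGuard_of_eisensteinHalfFiveLe (eisensteinHalfFiveLe_of_thm13_OPEN hPub h13)

/-- **THIN-GUARD BY NAME on road V**: `thm15_pPart_OPEN → GZK → THIN-GUARD`. CONDITIONAL; credits nothing.
[claim: BurungaleSkinnerTianWan2024, status: under-review] [cite: Kobayashi2003, Thm. 1.2 (p. 2)] -/
theorem eisensteinHalfFiveLeRestThinGuard_of_thm15_OPEN (h15 : thm15_pPart_OPEN)
    (hGZK : rank_eq_analyticRank_of_analyticRank_le_one) :
    ∀ (W : WeierstrassCurve ℚ) [W.IsElliptic] [W.IsGloballyMinimal] (p : ℕ) [Fact p.Prime],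
      ¬ W.HasCM → 5 ≤ p → ClassX6 W p → W.analyticRank = 0 → ¬ HasErratumPrime W p → ¬ HasInertPairPrimeToUnits W p →
      ∀ q : ℚ, shaAn W = (q : ℂ) → padicValRat p q ≠ 0 → padicValRat p q ≤ (padicValNat p W.shaOrder : ℤ) :=
  eisensteinHalfFiveLeRestThinGuard_of_eisensteinHalfFiveLe (eisensteinHalfFiveLe_of_thm15_OPEN h15 hGZK)

/-- **THIN-GUARD from the sister crux** `KobayashiLowerHalfSemistable` (stmt-BirchSwinnertonDyer-19000, OPEN) + the inputs.
CONDITIONAL; closes nothing. [cite: Kobayashi2003, Thm. 1.2 and Conjecture (p. 2)] [cite: BDKim2013, Cor. 3.15 (p. 199)] -/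
theorem eisensteinHalfFiveLeRestThinGuard_of_kobayashiLowerHalfSemistable
    (h : Summit.BirchSwinnertonDyer.BirchSwinnertonDyer.Theses.SignedLowerHalves.KobayashiLowerHalfSemistable)
    (hPub : PublishedInputsX6) :
    ∀ (W : WeierstrassCurve ℚ) [W.IsElliptic] [W.IsGloballyMinimal] (p : ℕ) [Fact p.Prime],
      ¬ W.HasCM → 5 ≤ p → ClassX6 W p → W.analyticRank = 0 → ¬ HasErratumPrime W p → ¬ HasInertPairPrimeToUnits W p →
      ∀ q : ℚ, shaAn W = (q : ℂ) → padicValRat p q ≠ 0 → padicValRat p q ≤ (padicValNat p W.shaOrder : ℤ) :=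
  eisensteinHalfFiveLeRestThinGuard_of_eisensteinHalfFiveLe (eisensteinHalves_of_kobayashiLowerHalfSemistable h hPub).1

end Summit.BirchSwinnertonDyer.BirchSwinnertonDyer.Theorems.PrintX6

end
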